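import Summits.ABC.StewartYu.KappaDoorSlot
import HarnessLib

/-!
# Cell abc-stewartyu, PATH Z: the WALDSCHMIDT-shape odd-prime estimates (`(log B + log log A)·log log A`)
# also fill the κ-door's odd slot — `(κ, σ, τ, τ₁) = (1, 2, 1, 2)` — hence give `EpsShapeBoundOne`

`Summits/ABC/StewartYu/YuNinetyW80KappaTransfer.lean` — cell `abc-stewartyu` (HOME
`run/shared/lean/pub/abc-stewartyu/`, seat p3 (g2); theorems only, no definition, no named fact), the
Waldschmidt-shape twin of `YuNinetyOddTransfer.lean` (Yu shape, `(τ, τ₁) = (1, 1)`).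

Context: p2-g2's memo-04 §2 (the landed architecture yields `(log B + log log A)·log log A`, not Yu's
`log B · log log A`) and its remark that the κ-door `KappaDoor.FinBoundAt p K L κ σ τ τ₁` has FREE powers
`τ, τ₁`: with `log log A ≤ 2 log max(3, ∏ qᵢ) =: 2Y` and `log B, Y ≥ 1`,
`(log B + log log A)·log log A ≤ (log B + 2Y)·2Y ≤ 8·log B·Y²`, so the Waldschmidt-shape residue-class
texts (as in `YuNinetyW80Transfer.lean`) give `FinBoundAt p 8 (2·max(1,|c₅|,|c₅'|)) 1 2 1 2` at every odd
prime — and the landed odd κ-door (`KappaDoor.epsShapeBound_of_oddFinBound`, any `τ, τ₁`) then gives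
`EpsShapeBound 1` (sequel `YuNinetyW80RadOne.lean`). So rung A1.M2⁻ (`rad^{1+ε}`) follows from PATH-Z
engines with NO door work and NO Yu product shape.

Main results: `YuNinetyW80Kappa.finBoundAt_of_residueClass_aux`, `finBoundAt_of_residueClasses`,
`oddTransferW80`. Everything is [folklore] bookkeeping. WHAT THIS IS NOT: no `p`-adic estimate is proved
here — the Waldschmidt-shape residue-class estimates are hypotheses.
-/

noncomputable section

open Finset Real

namespace Summit.ABC.StewartYu

namespace YuNinetyW80Kappa

open KappaDoor

/-- The WALDSCHMIDT-shape residue-class estimate at the primes with constant `c₅` gives the κ-door's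
`Fin`-indexed one-prime input `FinBoundAt p 8 (2c) 1 2 1 2` (`|c₅| ≤ c`, `1 ≤ c`). [folklore] -/
theorem finBoundAt_of_residueClass_aux {p : ℕ} (hp : p.Prime) {c₅ : ℝ}
    (hY : ∀ (S : Finset ℕ), (∀ q ∈ S, q.Prime) → p ∉ S → S.Nonempty →
      ∀ (e : ℕ → ℤ) (B : ℝ), 3 ≤ B → (∀ q ∈ S, (|e q| : ℝ) ≤ B) → ∏ q ∈ S, (q : ℚ) ^ e q ≠ 1 →
      (padicValRat p (∏ q ∈ S, (q : ℚ) ^ e q - 1) : ℝ) <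
        (c₅ * S.card) ^ S.card * (p : ℝ) ^ 2 *
          ((Real.log B + Real.log (Real.log ((max 4 (S.sup id) : ℕ) : ℝ))) *
            Real.log (Real.log ((max 4 (S.sup id) : ℕ) : ℝ))) * ∏ q ∈ S, Real.log ((max 4 q : ℕ) : ℝ))
    {c : ℝ} (hc1 : 1 ≤ c) (hc : |c₅| ≤ c) :
    FinBoundAt p 8 (2 * c) 1 2 1 2 := by
  classical
  intro n q e hq hinj hqp he hne1
  -- `n ≥ 1`
  have hn : 1 ≤ n := by
    rcases Nat.eq_zero_or_pos n with h0 | h0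
    · subst h0; exact absurd (funext fun i => Fin.elim0 i) he
    · exact h0
  -- the Finset data
  set S : Finset ℕ := Finset.univ.image q with hS
  set e' : ℕ → ℤ := Function.extend q e 0 with he'
  have he'q : ∀ i, e' (q i) = e i := fun i => hinj.extend_apply e 0 i
  have hSprime : ∀ m ∈ S, m.Prime := by
    intro m hm
    obtain ⟨i, -, rfl⟩ := Finset.mem_image.mp hm
    exact hq i
  have hpS : p ∉ S := by
    intro hm
    obtain ⟨i, -, hi⟩ := Finset.mem_image.mp hm
    exact hqp i hi
  have hSne : S.Nonempty := ⟨q ⟨0, hn⟩, Finset.mem_image.mpr ⟨⟨0, hn⟩, Finset.mem_univ _, rfl⟩⟩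
  have hcard : S.card = n := by
    rw [hS, Finset.card_image_of_injective _ hinj, Finset.card_univ, Fintype.card_fin]
  -- the exponent bound `B`
  set Bn : ℕ := max 3 (Finset.univ.sup fun i => (e i).natAbs) with hBn
  set B : ℝ := (Bn : ℝ) with hB
  have hB3 : (3 : ℝ) ≤ B := by
    rw [hB, hBn]; exact_mod_cast le_max_left _ _
  have heB : ∀ m ∈ S, (|e' m| : ℝ) ≤ B := by
    intro m hm
    obtain ⟨i, -, rfl⟩ := Finset.mem_image.mp hm
    rw [he'q i, hB, hBn]
    have h1 : (e i).natAbs ≤ Finset.univ.sup fun i => (e i).natAbs :=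
      Finset.le_sup (f := fun i => (e i).natAbs) (Finset.mem_univ i)
    have h3 : ((e i).natAbs : ℝ) = |(e i : ℝ)| := by
      rw [Nat.cast_natAbs, Int.cast_abs]
    rw [← h3]
    exact_mod_cast h1.trans (le_max_right _ _)
  -- the products over `S` are the products over `Fin n`
  have hprodQ : ∏ m ∈ S, (m : ℚ) ^ e' m = ∏ i, (q i : ℚ) ^ e i := by
    rw [hS, Finset.prod_image fun i _ j _ h => hinj h]
    exact Finset.prod_congr rfl fun i _ => by rw [he'q i]
  have hprodLog : ∏ m ∈ S, Real.log ((max 4 m : ℕ) : ℝ) = ∏ i, Real.log ((max 4 (q i) : ℕ) : ℝ) := by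
    rw [hS, Finset.prod_image fun i _ j _ h => hinj h]
  have hne1' : ∏ m ∈ S, (m : ℚ) ^ e' m ≠ 1 := by rwa [hprodQ]
  -- the residue-class estimate
  have key := hY S hSprime hpS hSne e' B hB3 heB hne1'
  rw [hprodQ, hcard, hprodLog] at key
  -- positivity of the factors
  have hq2 : ∀ i, 2 ≤ q i := fun i => (hq i).two_le
  have hlogq : ∀ i, 0 < Real.log (q i) := fun i =>
    Real.log_pos (by exact_mod_cast lt_of_lt_of_le (by norm_num) (hq2 i))
  have hPlog : 0 < ∏ i, Real.log (q i : ℝ) := Finset.prod_pos fun i _ => hlogq i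
  have hlogB : 0 < Real.log B := Real.log_pos (by linarith)
  set P : ℕ := ∏ i, q i with hP
  have hP1 : 1 ≤ P := by
    rw [hP]; exact Finset.one_le_prod' fun i _ => le_trans (by norm_num) (hq2 i)
  have hlogM : 0 < Real.log (max 3 (P : ℝ)) :=
    Real.log_pos (lt_of_lt_of_le (by norm_num) (le_max_left _ _))
  have hpR : (0 : ℝ) < (p : ℝ) ^ 2 := by
    have := hp.pos; positivity
  -- (1) `(c₅ n)ⁿ ≤ cⁿ nⁿ`
  have h1 : (c₅ * n) ^ n ≤ c ^ n * (n : ℝ) ^ n := by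
    calc (c₅ * n) ^ n ≤ |(c₅ * n) ^ n| := le_abs_self _
      _ = (|c₅| * n) ^ n := by rw [abs_pow, abs_mul, Nat.abs_cast]
      _ ≤ (c * n) ^ n := pow_le_pow_left₀ (by positivity) (by gcongr) n
      _ = c ^ n * (n : ℝ) ^ n := mul_pow _ _ _
  -- (2) `log max(4, q) ≤ 2 log q`
  have h2 : ∀ i, Real.log ((max 4 (q i) : ℕ) : ℝ) ≤ 2 * Real.log (q i) := by
    intro i
    have hq2' : (2 : ℝ) ≤ q i := by exact_mod_cast hq2 i
    have hle : ((max 4 (q i) : ℕ) : ℝ) ≤ (q i : ℝ) ^ 2 := by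
      rcases le_or_gt 4 (q i) with h | h
      · rw [max_eq_right h]
        have h4 : (4 : ℝ) ≤ q i := by exact_mod_cast h
        nlinarith
      · rw [max_eq_left h.le]; push_cast; nlinarith
    calc Real.log ((max 4 (q i) : ℕ) : ℝ) ≤ Real.log ((q i : ℝ) ^ 2) :=
          Real.log_le_log (by positivity) hle
      _ = 2 * Real.log (q i) := by rw [Real.log_pow]; push_cast; ring
  have h2' : ∏ i, Real.log ((max 4 (q i) : ℕ) : ℝ) ≤ 2 ^ n * ∏ i, Real.log (q i : ℝ) := by
    calc ∏ i, Real.log ((max 4 (q i) : ℕ) : ℝ) ≤ ∏ i, (2 * Real.log (q i : ℝ)) :=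
          Finset.prod_le_prod (fun i _ => Real.log_nonneg (by
            have : (4 : ℝ) ≤ ((max 4 (q i) : ℕ) : ℝ) := by exact_mod_cast le_max_left _ _
            linarith)) fun i _ => h2 i
      _ = 2 ^ n * ∏ i, Real.log (q i : ℝ) := by
          rw [Finset.prod_mul_distrib, Finset.prod_const, Finset.card_univ, Fintype.card_fin]
  have hlog4pos : 0 ≤ ∏ i, Real.log ((max 4 (q i) : ℕ) : ℝ) :=
    Finset.prod_nonneg fun i _ => Real.log_nonneg (by
      have : (4 : ℝ) ≤ ((max 4 (q i) : ℕ) : ℝ) := by exact_mod_cast le_max_left _ _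
      linarith)
  -- (3) `log log max(4, max S) ≤ 2 log max(3, ∏ qᵢ)`
  have hsupP : S.sup id ≤ P := by
    refine Finset.sup_le fun m hm => ?_
    obtain ⟨i, -, rfl⟩ := Finset.mem_image.mp hm
    rw [hP, id]
    exact Nat.le_of_dvd (lt_of_lt_of_le Nat.zero_lt_one hP1) (Finset.dvd_prod_of_mem q (mem_univ i))
  have hA4 : (4 : ℝ) ≤ ((max 4 (S.sup id) : ℕ) : ℝ) := by exact_mod_cast le_max_left _ _
  have hAle : ((max 4 (S.sup id) : ℕ) : ℝ) ≤ (4 / 3) * max 3 (P : ℝ) := by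
    rcases le_or_gt 4 (S.sup id) with h | h
    · rw [max_eq_right h]
      have : ((S.sup id : ℕ) : ℝ) ≤ (P : ℝ) := by exact_mod_cast hsupP
      calc ((S.sup id : ℕ) : ℝ) ≤ (P : ℝ) := this
        _ ≤ max 3 (P : ℝ) := le_max_right _ _
        _ ≤ (4 / 3) * max 3 (P : ℝ) := by
            have : 0 ≤ max 3 (P : ℝ) := le_trans (by norm_num) (le_max_left _ _)
            linarith
    · rw [max_eq_left h.le]; push_cast
      have : (3 : ℝ) ≤ max 3 (P : ℝ) := le_max_left _ _
      linarith
  have h3 : Real.log (Real.log ((max 4 (S.sup id) : ℕ) : ℝ)) ≤ 2 * Real.log (max 3 (P : ℝ)) := by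
    have hlogA : 0 < Real.log ((max 4 (S.sup id) : ℕ) : ℝ) := Real.log_pos (by linarith)
    -- `log log A ≤ log A − 1 ≤ log(4/3) + log max(3,P) − 1 ≤ log max(3,P)`
    have hM3 : (3 : ℝ) ≤ max 3 (P : ℝ) := le_max_left _ _
    calc Real.log (Real.log ((max 4 (S.sup id) : ℕ) : ℝ))
        ≤ Real.log ((max 4 (S.sup id) : ℕ) : ℝ) - 1 := Real.log_le_sub_one_of_pos hlogA
      _ ≤ Real.log ((4 / 3) * max 3 (P : ℝ)) - 1 := by
          gcongr
      _ = Real.log (4 / 3) + Real.log (max 3 (P : ℝ)) - 1 := by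
          rw [Real.log_mul (by norm_num) (by positivity)]
      _ ≤ Real.log (max 3 (P : ℝ)) := by
          have : Real.log (4 / 3) ≤ 4 / 3 - 1 := Real.log_le_sub_one_of_pos (by norm_num)
          linarith
      _ ≤ 2 * Real.log (max 3 (P : ℝ)) := by linarith
  have hloglogpos : 0 < Real.log (Real.log ((max 4 (S.sup id) : ℕ) : ℝ)) := by
    apply Real.log_pos
    have h4 : Real.log 4 ≤ Real.log ((max 4 (S.sup id) : ℕ) : ℝ) :=
      Real.log_le_log (by norm_num) hA4
    have : (1 : ℝ) < Real.log 4 := by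
      have h := Real.exp_one_lt_d9
      have : Real.exp 1 < 4 := by linarith
      calc (1 : ℝ) = Real.log (Real.exp 1) := (Real.log_exp 1).symm
        _ < Real.log 4 := Real.log_lt_log (Real.exp_pos 1) this
    linarith
  -- assemble
  have hP' : (max 3 (∏ i, ((q i : ℕ) : ℝ))) = max 3 (P : ℝ) := by rw [hP]; push_cast; rfl
  rw [hP', pow_one, one_mul, Real.rpow_natCast, Real.rpow_two]
  -- the Waldschmidt-shape `W`-factor: `(log B + log log A)·log log A ≤ 8 · log B · (log max(3, ∏q))²`
  set LLA : ℝ := Real.log (Real.log ((max 4 (S.sup id) : ℕ) : ℝ)) with hLLA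
  set Y : ℝ := Real.log (max 3 (P : ℝ)) with hY
  have hY1 : 1 ≤ Y := by
    rw [hY, ← Real.log_exp 1]
    apply Real.log_le_log (Real.exp_pos 1)
    have := Real.exp_one_lt_d9
    have h3 : (3 : ℝ) ≤ max 3 (P : ℝ) := le_max_left _ _
    linarith
  have hB1 : 1 ≤ Real.log B := by
    rw [← Real.log_exp 1]
    apply Real.log_le_log (Real.exp_pos 1)
    have := Real.exp_one_lt_d9; linarith
  have hW8 : (Real.log B + LLA) * LLA ≤ 8 * Real.log B * Y ^ 2 := by
    have hsum : Real.log B + 2 * Y ≤ 4 * Real.log B * Y := by nlinarith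
    calc (Real.log B + LLA) * LLA ≤ (Real.log B + 2 * Y) * (2 * Y) :=
          mul_le_mul (by linarith) h3 hloglogpos.le (by linarith)
      _ ≤ (4 * Real.log B * Y) * (2 * Y) := mul_le_mul_of_nonneg_right hsum (by linarith)
      _ = 8 * Real.log B * Y ^ 2 := by ring
  have hW0 : 0 ≤ (Real.log B + LLA) * LLA := mul_nonneg (by linarith) hloglogpos.le
  have step : (c₅ * n) ^ n * (p : ℝ) ^ 2 * ((Real.log B + LLA) * LLA) *
      ∏ i, Real.log ((max 4 (q i) : ℕ) : ℝ) ≤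
      8 * (2 * c) ^ n * (n : ℝ) ^ n * (p : ℝ) ^ 2 * (∏ i, Real.log (q i : ℝ)) * Real.log B *
        Y ^ 2 := by
    calc (c₅ * n) ^ n * (p : ℝ) ^ 2 * ((Real.log B + LLA) * LLA) *
          ∏ i, Real.log ((max 4 (q i) : ℕ) : ℝ)
        ≤ (c ^ n * (n : ℝ) ^ n) * (p : ℝ) ^ 2 * (8 * Real.log B * Y ^ 2) *
          (2 ^ n * ∏ i, Real.log (q i : ℝ)) := by
          gcongr
      _ = 8 * (2 * c) ^ n * (n : ℝ) ^ n * (p : ℝ) ^ 2 * (∏ i, Real.log (q i : ℝ)) * Real.log B *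
          Y ^ 2 := by rw [mul_pow]; ring
  have hB' : B = max (3 : ℝ) (((Finset.univ.sup fun i => (e i).natAbs : ℕ) : ℕ) : ℝ) := by
    rw [hB, hBn, Nat.cast_max]; push_cast; rfl
  rw [← hB']
  exact (key.le.trans step)

/-- **The odd transfer, Waldschmidt shape, unbundled.** The Waldschmidt-shape estimates at
`p ≡ 3 (mod 4)` (constant `c₅`) and `p ≡ 1 (mod 4)` (constant `c₅'`) give, at EVERY odd prime `p`,
`FinBoundAt p 8 (2·max(1, |c₅|, |c₅'|)) 1 2 1 2`. [folklore] -/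
theorem finBoundAt_of_residueClasses {c₅ c₅' : ℝ}
    (h₃ : ∀ (p : ℕ), p.Prime → p % 4 = 3 → ∀ (S : Finset ℕ), (∀ q ∈ S, q.Prime) → p ∉ S →
      S.Nonempty → ∀ (e : ℕ → ℤ) (B : ℝ), 3 ≤ B → (∀ q ∈ S, (|e q| : ℝ) ≤ B) →
      ∏ q ∈ S, (q : ℚ) ^ e q ≠ 1 →
      (padicValRat p (∏ q ∈ S, (q : ℚ) ^ e q - 1) : ℝ) <
        (c₅ * S.card) ^ S.card * (p : ℝ) ^ 2 *
          ((Real.log B + Real.log (Real.log ((max 4 (S.sup id) : ℕ) : ℝ))) *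
            Real.log (Real.log ((max 4 (S.sup id) : ℕ) : ℝ))) * ∏ q ∈ S, Real.log ((max 4 q : ℕ) : ℝ))
    (h₁ : ∀ (p : ℕ), p.Prime → p % 4 = 1 → ∀ (S : Finset ℕ), (∀ q ∈ S, q.Prime) → p ∉ S →
      S.Nonempty → ∀ (e : ℕ → ℤ) (B : ℝ), 3 ≤ B → (∀ q ∈ S, (|e q| : ℝ) ≤ B) →
      ∏ q ∈ S, (q : ℚ) ^ e q ≠ 1 →
      (padicValRat p (∏ q ∈ S, (q : ℚ) ^ e q - 1) : ℝ) <
        (c₅' * S.card) ^ S.card * (p : ℝ) ^ 2 *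
          ((Real.log B + Real.log (Real.log ((max 4 (S.sup id) : ℕ) : ℝ))) *
            Real.log (Real.log ((max 4 (S.sup id) : ℕ) : ℝ))) * ∏ q ∈ S, Real.log ((max 4 q : ℕ) : ℝ))
    {p : ℕ} (hp : p.Prime) (hp2 : p ≠ 2) :
    FinBoundAt p 8 (2 * max 1 (max |c₅| |c₅'|)) 1 2 1 2 := by
  have hc1 : (1 : ℝ) ≤ max 1 (max |c₅| |c₅'|) := le_max_left _ _
  have hndvd : ¬ 2 ∣ p := fun hd =>
    hp2 ((hp.eq_one_or_self_of_dvd 2 hd).resolve_left (by norm_num)).symm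
  have hodd : p % 4 = 1 ∨ p % 4 = 3 := by omega
  rcases hodd with h | h
  · exact finBoundAt_of_residueClass_aux hp (h₁ p hp h) hc1
      ((le_max_right _ _).trans (le_max_right _ _))
  · exact finBoundAt_of_residueClass_aux hp (h₃ p hp h) hc1
      ((le_max_left _ _).trans (le_max_right _ _))

/-- **The odd transfer, Waldschmidt shape (the `OddTransferSpec` of a PATH-Z restatement of rung route
A1.M2⁻).** The two Waldschmidt-shape residue-class estimates give constants `K ≥ 0`, `L ≥ 1` with the
κ-door's one-prime bound at every odd prime, `(κ, σ, τ, τ₁) = (1, 2, 1, 2)`: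
`ord_p(∏ qᵢ^{eᵢ} − 1) ≤ K·Lⁿ·nⁿ·p²·(∏ log qᵢ)·log max(3, max|eᵢ|)·(log max(3, ∏ qᵢ))²`
(`K = 8`, `L = 2·max(1, |c₅|, |c₅'|)`). [folklore] -/
theorem oddTransferW80 :
    (∃ c₅ : ℝ, ∀ (p : ℕ), p.Prime → p % 4 = 3 → ∀ (S : Finset ℕ), (∀ q ∈ S, q.Prime) → p ∉ S →
      S.Nonempty → ∀ (e : ℕ → ℤ) (B : ℝ), 3 ≤ B → (∀ q ∈ S, (|e q| : ℝ) ≤ B) →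
      ∏ q ∈ S, (q : ℚ) ^ e q ≠ 1 →
      (padicValRat p (∏ q ∈ S, (q : ℚ) ^ e q - 1) : ℝ) <
        (c₅ * S.card) ^ S.card * (p : ℝ) ^ 2 *
          ((Real.log B + Real.log (Real.log ((max 4 (S.sup id) : ℕ) : ℝ))) *
            Real.log (Real.log ((max 4 (S.sup id) : ℕ) : ℝ))) * ∏ q ∈ S, Real.log ((max 4 q : ℕ) : ℝ)) →
    (∃ c₅ : ℝ, ∀ (p : ℕ), p.Prime → p % 4 = 1 → ∀ (S : Finset ℕ), (∀ q ∈ S, q.Prime) → p ∉ S →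
      S.Nonempty → ∀ (e : ℕ → ℤ) (B : ℝ), 3 ≤ B → (∀ q ∈ S, (|e q| : ℝ) ≤ B) →
      ∏ q ∈ S, (q : ℚ) ^ e q ≠ 1 →
      (padicValRat p (∏ q ∈ S, (q : ℚ) ^ e q - 1) : ℝ) <
        (c₅ * S.card) ^ S.card * (p : ℝ) ^ 2 *
          ((Real.log B + Real.log (Real.log ((max 4 (S.sup id) : ℕ) : ℝ))) *
            Real.log (Real.log ((max 4 (S.sup id) : ℕ) : ℝ))) * ∏ q ∈ S, Real.log ((max 4 q : ℕ) : ℝ)) →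
    ∃ (K L : ℝ), 0 ≤ K ∧ 1 ≤ L ∧ ∀ p, p.Prime → p ≠ 2 →
      (∀ (n : ℕ) (q : Fin n → ℕ) (e : Fin n → ℤ), (∀ i, (q i).Prime) → Function.Injective q →
        (∀ i, q i ≠ p) → e ≠ 0 → ∏ i, ((q i : ℚ)) ^ e i ≠ 1 →
        (padicValRat p (∏ i, ((q i : ℚ)) ^ e i - 1) : ℝ) ≤
          K * L ^ n * (n : ℝ) ^ ((1 : ℝ) * n) * (p : ℝ) ^ (2 : ℝ) * (∏ i, Real.log (q i)) *
            Real.log (max 3 ((Finset.univ.sup fun i => (e i).natAbs : ℕ) : ℝ)) ^ (1 : ℕ) *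
            Real.log (max 3 (∏ i, ((q i : ℕ) : ℝ))) ^ (2 : ℕ)) := by
  rintro ⟨c₅, h₃⟩ ⟨c₅', h₁⟩
  refine ⟨8, 2 * max 1 (max |c₅| |c₅'|), by norm_num, ?_, fun p hp hp2 => ?_⟩
  · have : (1 : ℝ) ≤ max 1 (max |c₅| |c₅'|) := le_max_left _ _
    linarith
  · exact finBoundAt_of_residueClasses h₃ h₁ hp hp2

end YuNinetyW80Kappa

end Summit.ABC.StewartYu

end
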